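import Literature.Barriers.RiemannHypothesis.BettinGonek2017LowerBoundProofs
import Literature.NumberTheory.LFunctions.ZetaMeanSquareLowerBound
import HarnessLib

/-!
# Bettin–Gonek 2017, Theorem 2 (the dyadic moment) discharged

Sibling proof file of `Literature/Barriers/RiemannHypothesis/MollifierLimitations.lean`, after
`BettinGonek2017Proofs.lean` (the named fact `BettinGonek2017_lowerBound`, the integer/real
length bridge and the endgame of Theorem 1) and `BettinGonek2017LowerBoundProofs.lean`
(`BettinGonek2017_lowerBound_holds`, `BettinGonek2017_thm1_holds`). S. Bettin, S. M. Gonek,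
*The θ = ∞ conjecture implies the Riemann hypothesis*, Mathematika 63 (2017) 29–33 =
arXiv:1604.02740, **Theorem 2**: "Let `θ > 0` and assume that for every `ε > 0` we have
`I_N(T,2T) ≪_ε T^{1+ε}` for `N` in the range `2 ≤ N ≤ T^θ`. Then `ζ(s)` has no zeros in the
half-plane `Re s > 1/2 + 2/θ`." The printed proof (§2, last paragraph): "Theorem 2 follows in the
same way [as Theorem 1] on taking `T₁ = T` and `T₂ = 2T`", i.e. from the displays

* `x^{2β₀}/(1+|t|)⁴ + 1/x ≪ ∫_1^x |M_y(½+it)|² log² y dy` (`x ≥ 2`, all `t`) — the key lower bound,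
  PROVED in the tree as `BettinGonek2017_lowerBound_holds`;
* "Multiplying both sides by `|ζ(½+it)|²` and integrating […] over `[T₁,T₂]`":
  `∫_{T₁}^{T₂} |ζ(½+it)|² (x^{2β₀}/(1+t)⁴ + 1/x) dt ≪ log² x ∫_1^x I_y(T₁,T₂) dy`;
* "`∫_{T₁}^{T₂} |ζ(½+it)|² dt ≫ T₂ log(T₂+2)` for `0 ≤ T₁ ≤ T₂/2`" (Hardy–Littlewood), whence
  `x^{2β₀} log(T₁+2)/|1+T₁|³ + T₂ log(T₂+2)/x ≪ log² x ∫_1^x I_y(T₁,T₂) dy`, and with `T₁ = T`,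
  `T₂ = 2T`, `x = T^θ`: `T^{2β₀θ-3} ≪ T^{θ+1+ε}`, i.e. `β₀ ≤ ½ + 2/θ`.

## What is proved here

* `BettinGonek2017_lowerBound_integrated_Icc` — the integration step over a general `[T₁, T₂]`,
  `0 ≤ T₁ ≤ T₂`, with the integer/real length bridge of `BettinGonek2017Proofs.lean`:
  `(c x^{2β}/(1+T₂)⁴) ∫_{T₁}^{T₂} |ζ(½+it)|² dt ≤ 2 ∑_{N ≤ ⌊x⌋+1} log² N · I_N(T₁,T₂)`.
* `sum_log_sq_mul_moment_Icc_le` — using the hypothesis of Theorem 2 at the same `T`.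
* `BettinGonek2017_thm2_of_lowerBound` — Theorem 2 from the key lower bound and ANY mean-square
  lower bound `∫_T^{2T} |ζ(½+it)|² dt ≥ c T` (`T ≥ T₁`); the logarithm in the printed input
  `≫ T₂ log(T₂+2)` is not needed (`T^{2β₀θ-3} ≪ T^{θ+1+ε} log² T` already forces
  `β₀ ≤ ½ + 2/θ`).
* `BettinGonek2017_thm2_holds` — **discharge of `BettinGonek2017_thm2`**, the mean-square input
  being `Literature.NumberTheory.LFunctions.exists_integral_norm_sq_riemannZeta_Icc_ge`
  (`∫_T^{2T} |ζ(½+it)|² dt ≥ T/64` for `T ≥ 3·10⁵`, proved in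
  `Literature/NumberTheory/LFunctions/ZetaMeanSquareLowerBound.lean`).
* `riemannHypothesis_of_mollifiedSecondMoment_dyadic_bound` — the printed "In particular, if
  `I_N(T,2T) ≪_ε T^{1+ε}` for `2 ≤ N ≤ T^θ` with `θ` arbitrarily large, then the Riemann
  hypothesis is true", now unconditional in its analytic inputs.

## Design notes

* In Theorem 1 the hypothesis at `T' = 2^{1/θ} T` and the monotonicity of `I_N(0, ·)` cover the
  lengths `N ≤ ⌊T^θ⌋ + 1`; for the dyadic moment `I_N(T,2T)` this does not work (the intervals
  `[T,2T]` and `[T',2T']` are not nested), so here `x = T^θ/2`, for which `⌊x⌋ + 1 ≤ T^θ` and the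
  hypothesis at the same `T` applies; this costs the constant `2^{-2β₀} ≥ 1/4`.
* With `2β₀θ - 3 = θ + 1 + 4η`, `ε = η`, `log T^θ ≤ θ T^η/η` and `(1+2T)⁴ ≤ 81 T⁴` the printed
  "`T^{2β₀θ-3} ≪ T^{θ+1+ε}`, let `T → ∞`" becomes `T^η ≤ const`, contradicting `T^η → ∞`
  (`false_of_rpow_le` of `BettinGonek2017Proofs.lean`).

## References

* [BettinGonek2017] S. Bettin, S. M. Gonek, *The θ = ∞ conjecture implies the Riemann
  hypothesis*, Mathematika 63 (2017), no. 1, 29–33; arXiv:1604.02740: Thm. 2 (p. 3), §2 (p. 4: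
  the display after "Multiplying both sides by `|ζ(½+it)|²`", the display using
  `∫|ζ|² ≫ T₂ log(T₂+2)`, and the closing sentence "Theorem 2 follows in the same way on taking
  `T₁ = T` and `T₂ = 2T`").
* [Titchmarsh1986] E. C. Titchmarsh, *The Theory of the Riemann Zeta-Function*, 2nd ed. (1986),
  Theorem 7.3 (the mean value theorem behind the printed `≫ T₂ log(T₂+2)`).
-/

noncomputable section

open Complex MeasureTheory Real

namespace Literature.Barriers.RiemannHypothesis

/-- **Integrating the key lower bound against `|ζ(½+it)|²` over `t ∈ [T₁, T₂]`** (`0 ≤ T₁ ≤ T₂`):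
if for all `t`, `c (x^{2β}/(1+|t|)⁴ + 1/x) ≤ ∫_1^x ‖M_y(½+it) log y‖² dy` (`x ≥ 2`, `c ≥ 0`), then
`(c x^{2β}/(1+T₂)⁴) ∫_{T₁}^{T₂} |ζ(½+it)|² dt ≤ 2 ∑_{N ≤ ⌊x⌋+1} log² N · I_N(T₁, T₂)`
(Bettin–Gonek: "Multiplying both sides by `|ζ(½+it)|²` and integrating […] over `[T₁,T₂]`").
[cite: BettinGonek2017, §2] -/
theorem BettinGonek2017_lowerBound_integrated_Icc {c β x T₁ T₂ : ℝ} (hx : 2 ≤ x) (hc : 0 ≤ c)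
    (hT₁ : 0 ≤ T₁) (hT₁₂ : T₁ ≤ T₂)
    (hlb : ∀ t : ℝ, c * (x ^ (2 * β) / (1 + |t|) ^ 4 + 1 / x) ≤
      ∫ y in (1 : ℝ)..x, ‖levinsonMollifierLog y (1 / 2 + t * I)‖ ^ 2) :
    c * x ^ (2 * β) / (1 + T₂) ^ 4 * (∫ t in T₁..T₂, ‖riemannZeta (1 / 2 + t * I)‖ ^ 2) ≤
      2 * ∑ N ∈ Finset.Icc 1 (⌊x⌋₊ + 1), Real.log N ^ 2 * mollifiedSecondMoment N T₁ T₂ := by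
  set K := ⌊x⌋₊ with hK
  set Z : ℝ → ℝ := fun t ↦ ‖riemannZeta (1 / 2 + t * I)‖ ^ 2 with hZ
  set L : ℕ → ℝ → ℝ := fun N t ↦ ‖levinsonMollifierLog (N : ℝ) (1 / 2 + t * I)‖ ^ 2 with hL
  have hZc : Continuous Z :=
    (Literature.NumberTheory.LFunctions.continuous_riemannZeta_line.norm).pow 2
  have hLc : ∀ N, Continuous (L N) := fun N ↦
    ((continuous_levinsonMollifierLog (N : ℝ)).comp (by fun_prop)).norm.pow 2
  -- pointwise inequality on `[T₁, T₂]`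
  have hpt : ∀ t ∈ Set.Icc T₁ T₂,
      c * x ^ (2 * β) / (1 + T₂) ^ 4 * Z t ≤ (2 * ∑ N ∈ Finset.Icc 1 (K + 1), L N t) * Z t := by
    intro t ht
    have hZ0 : 0 ≤ Z t := by positivity
    refine mul_le_mul_of_nonneg_right ?_ hZ0
    have ht0 : 0 ≤ t := hT₁.trans ht.1
    have h16 : (1 + |t|) ^ 4 ≤ (1 + T₂) ^ 4 := by
      rw [abs_of_nonneg ht0]; gcongr; exact ht.2
    have hx0 : 0 < x := by linarith
    have hxpow : 0 ≤ x ^ (2 * β) := Real.rpow_nonneg hx0.le _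
    have hpos : 0 < (1 + |t|) ^ 4 := by positivity
    calc c * x ^ (2 * β) / (1 + T₂) ^ 4 = c * (x ^ (2 * β) / (1 + T₂) ^ 4 + 0) := by ring
      _ ≤ c * (x ^ (2 * β) / (1 + |t|) ^ 4 + 1 / x) := by
          gcongr
          positivity
      _ ≤ ∫ y in (1 : ℝ)..x, ‖levinsonMollifierLog y (1 / 2 + t * I)‖ ^ 2 := hlb t
      _ ≤ ∑ N ∈ Finset.Icc 1 K, (L N t + L (N + 1) t) :=
          integral_norm_sq_levinsonMollifierLog_le (by linarith) (by norm_num)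
      _ ≤ 2 * ∑ N ∈ Finset.Icc 1 (K + 1), L N t :=
          sum_add_succ_le_two_mul (a := fun N ↦ L N t) (fun _ ↦ by positivity) K
  -- integrate over `[T₁, T₂]`
  have hRi : IntervalIntegrable (fun t ↦ (2 * ∑ N ∈ Finset.Icc 1 (K + 1), L N t) * Z t)
      volume T₁ T₂ :=
    ((continuous_const.mul (continuous_finsetSum _ fun N _ ↦ hLc N)).mul hZc).intervalIntegrable
      _ _
  have hLi : IntervalIntegrable (fun t ↦ c * x ^ (2 * β) / (1 + T₂) ^ 4 * Z t) volume T₁ T₂ :=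
    (continuous_const.mul hZc).intervalIntegrable _ _
  have hint := intervalIntegral.integral_mono_on hT₁₂ hLi hRi hpt
  rw [intervalIntegral.integral_const_mul] at hint
  refine hint.trans (le_of_eq ?_)
  have h1 : (fun t ↦ (2 * ∑ N ∈ Finset.Icc 1 (K + 1), L N t) * Z t) =
      fun t ↦ 2 * ∑ N ∈ Finset.Icc 1 (K + 1), L N t * Z t := by
    funext t; rw [mul_assoc, Finset.sum_mul]
  rw [h1, intervalIntegral.integral_const_mul,
    intervalIntegral.integral_finsetSum (f := fun N t ↦ L N t * Z t)
      fun N _ ↦ ((hLc N).mul hZc).intervalIntegrable _ _]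
  congr 1
  refine Finset.sum_congr rfl fun N _ ↦ ?_
  exact integral_norm_sq_levinsonMollifierLog_natCast N T₁ T₂

/-- **Using the hypothesis of Theorem 2** at the same `T`: if `I_N(T, 2T) ≤ C T^{1+ε}` for
`2 ≤ N ≤ T^θ` and `K + 1 ≤ T^θ`, then `∑_{N ≤ K+1} log² N · I_N(T, 2T) ≤ (K+1) log²(K+1) · C T^{1+ε}`
(the term `N = 1` vanishes). [cite: BettinGonek2017, §2] -/
theorem sum_log_sq_mul_moment_Icc_le {θ ε C T : ℝ} {K : ℕ} (hT : 0 ≤ T) (hK1 : 1 ≤ K)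
    (hK : ((K + 1 : ℕ) : ℝ) ≤ T ^ θ)
    (hC : ∀ N : ℕ, 2 ≤ N → (N : ℝ) ≤ T ^ θ → mollifiedSecondMoment N T (2 * T) ≤ C * T ^ (1 + ε)) :
    ∑ N ∈ Finset.Icc 1 (K + 1), Real.log N ^ 2 * mollifiedSecondMoment N T (2 * T) ≤
      ((K + 1 : ℕ) : ℝ) * (Real.log ((K + 1 : ℕ) : ℝ) ^ 2 * (C * T ^ (1 + ε))) := by
  have hT2 : T ≤ 2 * T := by linarith
  have h2K : ((2 : ℕ) : ℝ) ≤ T ^ θ := le_trans (by exact_mod_cast (by omega : 2 ≤ K + 1)) hK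
  have hC0 : 0 ≤ C * T ^ (1 + ε) :=
    (mollifiedSecondMoment_nonneg 2 hT2).trans (hC 2 le_rfl h2K)
  have hterm : ∀ N ∈ Finset.Icc 1 (K + 1), Real.log N ^ 2 * mollifiedSecondMoment N T (2 * T) ≤
      Real.log ((K + 1 : ℕ) : ℝ) ^ 2 * (C * T ^ (1 + ε)) := by
    intro N hN
    obtain ⟨hN1, hNK⟩ := Finset.mem_Icc.1 hN
    rcases eq_or_lt_of_le hN1 with h1 | h1
    · subst h1
      simp only [Nat.cast_one, Real.log_one, ne_eq, OfNat.ofNat_ne_zero, not_false_eq_true,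
        zero_pow, zero_mul]
      exact mul_nonneg (sq_nonneg _) hC0
    · have hN2 : 2 ≤ N := by omega
      have hlog : Real.log N ^ 2 ≤ Real.log ((K + 1 : ℕ) : ℝ) ^ 2 := by
        have h0 : 0 ≤ Real.log N := Real.log_nonneg (by exact_mod_cast hN1)
        have h1' : Real.log N ≤ Real.log ((K + 1 : ℕ) : ℝ) :=
          Real.log_le_log (by exact_mod_cast (by omega : 0 < N)) (by exact_mod_cast hNK)
        nlinarith
      have hmom : mollifiedSecondMoment N T (2 * T) ≤ C * T ^ (1 + ε) :=
        hC N hN2 ((show (N : ℝ) ≤ ((K + 1 : ℕ) : ℝ) by exact_mod_cast hNK).trans hK)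
      exact mul_le_mul hlog hmom (mollifiedSecondMoment_nonneg N hT2) (sq_nonneg _)
  calc ∑ N ∈ Finset.Icc 1 (K + 1), Real.log N ^ 2 * mollifiedSecondMoment N T (2 * T)
      ≤ ∑ N ∈ Finset.Icc 1 (K + 1), Real.log ((K + 1 : ℕ) : ℝ) ^ 2 * (C * T ^ (1 + ε)) :=
        Finset.sum_le_sum hterm
    _ = ((K + 1 : ℕ) : ℝ) * (Real.log ((K + 1 : ℕ) : ℝ) ^ 2 * (C * T ^ (1 + ε))) := by
        rw [Finset.sum_const, Nat.card_Icc, nsmul_eq_mul]; simp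

/-- **Bettin–Gonek 2017, Theorem 2, from the key lower bound of §2 and a mean-square lower bound
for `ζ` on `[T, 2T]`** ("Theorem 2 follows in the same way on taking `T₁ = T` and `T₂ = 2T`"):
if `ζ(ρ₀) = 0` with `β₀ > ½ + 2/θ`, integrate the lower bound against `|ζ(½+it)|²` over `[T, 2T]`,
bound the right side through `I_N(T,2T)`, `N ≤ ⌊x⌋ + 1 ≤ T^θ` with `x = T^θ/2`, and use
`∫_T^{2T} |ζ(½+it)|² dt ≫ T`: `T^{2β₀θ - 3} ≪ T^{θ+1+ε} log² T`, contradiction. The printed proof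
uses `∫_{T₁}^{T₂}|ζ(½+it)|² dt ≫ T₂ log(T₂+2)`; the logarithm is not needed.
[cite: BettinGonek2017, Theorem 2] -/
theorem BettinGonek2017_thm2_of_lowerBound (hLB : BettinGonek2017_lowerBound)
    (hMS : ∃ c : ℝ, 0 < c ∧ ∃ T₁ : ℝ, ∀ T : ℝ, T₁ ≤ T →
      c * T ≤ ∫ t in T..(2 * T), ‖riemannZeta (1 / 2 + t * I)‖ ^ 2) :
    BettinGonek2017_thm2 := by
  intro θ hθ hyp s hs hζ
  have hβ1 := Literature.NumberTheory.LFunctions.re_lt_one_of_riemannZeta_eq_zero hζ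
  have hβ : 1 / 2 < s.re := by
    have : 0 < 2 / θ := by positivity
    linarith
  have hgap : θ + 4 < 2 * s.re * θ := by
    have h := mul_lt_mul_of_pos_right hs (by positivity : (0 : ℝ) < 2 * θ)
    have e : (1 / 2 + 2 / θ) * (2 * θ) = θ + 4 := by field_simp; ring
    rw [e] at h; linarith
  set η : ℝ := (2 * s.re * θ - θ - 4) / 4 with hη
  have hη0 : 0 < η := by rw [hη]; linarith
  obtain ⟨C, hC⟩ := hyp η hη0
  obtain ⟨c, hc, hlb⟩ := hLB s hζ hβ.le
  obtain ⟨c₂, hc₂, T₁, hms⟩ := hMS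
  -- constants
  set A : ℝ := (4 : ℝ) ^ (1 / θ) with hA
  have hA1 : 1 ≤ A := Real.one_le_rpow (by norm_num) (by positivity)
  have hAθ : A ^ θ = 4 := by
    rw [hA, ← Real.rpow_mul (by norm_num), one_div_mul_cancel hθ.ne', Real.rpow_one]
  set D : ℝ := 2 * C * (θ / η) ^ 2 with hD
  refine false_of_rpow_le (η := η) (B := 324 * D / (c * c₂)) (T₀ := max (max 2 A) T₁) hη0
    fun T hT ↦ ?_
  -- fix a large `T`
  have hT2 : 2 ≤ T := le_trans (le_trans (le_max_left _ _) (le_max_left _ _)) hT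
  have hTA : A ≤ T := le_trans (le_trans (le_max_right _ _) (le_max_left _ _)) hT
  have hTT₁ : T₁ ≤ T := le_trans (le_max_right _ _) hT
  have hT0 : 0 < T := by linarith
  have hT1 : 1 ≤ T := by linarith
  have hTθ4 : 4 ≤ T ^ θ := by
    rw [← hAθ]; exact Real.rpow_le_rpow (by linarith) hTA hθ.le
  set x : ℝ := T ^ θ / 2 with hx
  have hx2 : 2 ≤ x := by rw [hx]; linarith
  have hx0 : 0 < x := by linarith
  set K := ⌊x⌋₊ with hK
  have hK1 : 1 ≤ K := Nat.le_floor (by norm_num; linarith)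
  have hKx : (K : ℝ) ≤ x := Nat.floor_le hx0.le
  have hKT : ((K + 1 : ℕ) : ℝ) ≤ T ^ θ := by
    push_cast
    have : T ^ θ = 2 * x := by rw [hx]; ring
    rw [this]; linarith
  -- the three inputs
  have h1 := BettinGonek2017_lowerBound_integrated_Icc (β := s.re) (T₁ := T) (T₂ := 2 * T) hx2 hc.le
    hT0.le (by linarith) (hlb x hx2)
  have h2 := sum_log_sq_mul_moment_Icc_le (ε := η) hT0.le hK1 hKT (hC T hT2)
  have h3 := hms T hTT₁
  set M : ℝ := ∫ t in T..(2 * T), ‖riemannZeta (1 / 2 + t * I)‖ ^ 2 with hM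
  have hM0 : c₂ * T ≤ M := h3
  have hcoef : 0 ≤ c * x ^ (2 * s.re) / (1 + 2 * T) ^ 4 := by positivity
  have h13 : c * x ^ (2 * s.re) / (1 + 2 * T) ^ 4 * (c₂ * T) ≤
      2 * (((K + 1 : ℕ) : ℝ) * (Real.log ((K + 1 : ℕ) : ℝ) ^ 2 * (C * T ^ (1 + η)))) :=
    calc c * x ^ (2 * s.re) / (1 + 2 * T) ^ 4 * (c₂ * T)
        ≤ c * x ^ (2 * s.re) / (1 + 2 * T) ^ 4 * M := by gcongr
      _ ≤ 2 * ∑ N ∈ Finset.Icc 1 (K + 1), Real.log N ^ 2 * mollifiedSecondMoment N T (2 * T) := h1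
      _ ≤ 2 * (((K + 1 : ℕ) : ℝ) * (Real.log ((K + 1 : ℕ) : ℝ) ^ 2 * (C * T ^ (1 + η)))) := by
          linarith
  -- sizes of the factors on the right
  have hC0 : 0 ≤ C * T ^ (1 + η) :=
    (mollifiedSecondMoment_nonneg 2 (by linarith)).trans
      (hC T hT2 2 le_rfl (le_trans (by exact_mod_cast (by omega : 2 ≤ K + 1)) hKT))
  have hlogT : Real.log T ≤ T ^ η / η := Real.log_le_rpow_div hT0.le hη0
  have hlogT0 : 0 ≤ Real.log T := Real.log_nonneg hT1
  have hlogK : Real.log ((K + 1 : ℕ) : ℝ) ≤ θ / η * T ^ η := by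
    calc Real.log ((K + 1 : ℕ) : ℝ) ≤ Real.log (T ^ θ) :=
          Real.log_le_log (by positivity) hKT
      _ = θ * Real.log T := Real.log_rpow hT0 θ
      _ ≤ θ * (T ^ η / η) := by gcongr
      _ = θ / η * T ^ η := by ring
  have hlog0 : 0 ≤ Real.log ((K + 1 : ℕ) : ℝ) := Real.log_nonneg (by exact_mod_cast (by omega))
  have hrhs : 2 * (((K + 1 : ℕ) : ℝ) * (Real.log ((K + 1 : ℕ) : ℝ) ^ 2 * (C * T ^ (1 + η)))) ≤
      D * (T ^ θ * (T ^ η) ^ 2 * T ^ (1 + η)) := by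
    calc 2 * (((K + 1 : ℕ) : ℝ) * (Real.log ((K + 1 : ℕ) : ℝ) ^ 2 * (C * T ^ (1 + η))))
        ≤ 2 * (T ^ θ * ((θ / η * T ^ η) ^ 2 * (C * T ^ (1 + η)))) := by gcongr
      _ = D * (T ^ θ * (T ^ η) ^ 2 * T ^ (1 + η)) := by rw [hD]; ring
  -- sizes of the factors on the left
  have h2T : (1 + 2 * T) ^ 4 ≤ 81 * T ^ 4 := by
    have h3 : 1 + 2 * T ≤ 3 * T := by linarith
    calc (1 + 2 * T) ^ 4 ≤ (3 * T) ^ 4 := pow_le_pow_left₀ (by linarith) h3 4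
      _ = 81 * T ^ 4 := by ring
  have hhalf : (1 / 4 : ℝ) ≤ (1 / 2 : ℝ) ^ (2 * s.re) := by
    calc (1 / 4 : ℝ) = (1 / 2 : ℝ) ^ (2 : ℝ) := by norm_num
      _ ≤ (1 / 2 : ℝ) ^ (2 * s.re) :=
          Real.rpow_le_rpow_of_exponent_ge (by norm_num) (by norm_num) (by linarith)
  have hxpow : T ^ (2 * s.re * θ) / 4 ≤ x ^ (2 * s.re) := by
    have e : x = T ^ θ * (1 / 2) := by rw [hx]; ring
    rw [e, Real.mul_rpow (by positivity) (by norm_num), ← Real.rpow_mul hT0.le,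
      show θ * (2 * s.re) = 2 * s.re * θ by ring]
    have := Real.rpow_nonneg hT0.le (2 * s.re * θ)
    calc T ^ (2 * s.re * θ) / 4 = T ^ (2 * s.re * θ) * (1 / 4) := by ring
      _ ≤ T ^ (2 * s.re * θ) * (1 / 2 : ℝ) ^ (2 * s.re) := by gcongr
  have hlhs : c * c₂ / 324 * (T ^ (2 * s.re * θ) / T ^ 4 * T) ≤
      c * x ^ (2 * s.re) / (1 + 2 * T) ^ 4 * (c₂ * T) := by
    have hT4 : 0 < T ^ 4 := by positivity
    have h81 : 0 < 81 * T ^ 4 := by positivity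
    calc c * c₂ / 324 * (T ^ (2 * s.re * θ) / T ^ 4 * T)
        = c * (T ^ (2 * s.re * θ) / 4) / (81 * T ^ 4) * (c₂ * T) := by field_simp; ring
      _ ≤ c * x ^ (2 * s.re) / (81 * T ^ 4) * (c₂ * T) := by gcongr
      _ ≤ c * x ^ (2 * s.re) / (1 + 2 * T) ^ 4 * (c₂ * T) := by
          gcongr
  -- exponent bookkeeping
  have hexp : T ^ θ * (T ^ η) ^ 2 * T ^ (1 + η) = T ^ (θ + 1 + 3 * η) := by
    rw [sq, ← Real.rpow_add hT0, ← Real.rpow_add hT0, ← Real.rpow_add hT0]; ring_nf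
  have hlhs' : T ^ (2 * s.re * θ) / T ^ 4 * T = T ^ (θ + 1 + 3 * η) * T ^ η := by
    rw [show (T ^ 4 : ℝ) = T ^ (4 : ℝ) by norm_cast, div_eq_mul_inv, ← Real.rpow_neg hT0.le,
      ← Real.rpow_add hT0, ← Real.rpow_add_one hT0.ne', ← Real.rpow_add hT0]
    congr 1; rw [hη]; ring
  have hmain : c * c₂ / 324 * (T ^ (θ + 1 + 3 * η) * T ^ η) ≤ D * T ^ (θ + 1 + 3 * η) := by
    have := (hlhs.trans h13).trans hrhs
    rw [hexp, hlhs'] at this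
    exact this
  have hpos : 0 < T ^ (θ + 1 + 3 * η) := Real.rpow_pos_of_pos hT0 _
  have hcc : 0 < c * c₂ := mul_pos hc hc₂
  have hkey : c * c₂ / 324 * T ^ η ≤ D := by
    refine le_of_mul_le_mul_right ?_ hpos
    calc c * c₂ / 324 * T ^ η * T ^ (θ + 1 + 3 * η)
        = c * c₂ / 324 * (T ^ (θ + 1 + 3 * η) * T ^ η) := by ring
      _ ≤ D * T ^ (θ + 1 + 3 * η) := hmain
  rw [le_div_iff₀ hcc]
  have e : T ^ η * (c * c₂) = 324 * (c * c₂ / 324 * T ^ η) := by ring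
  rw [e]
  linarith

/-- **Bettin–Gonek 2017, Theorem 2, discharged**: the fact `BettinGonek2017_thm2` of
`MollifierLimitations.lean` holds (the key lower bound of §2 is
`BettinGonek2017_lowerBound_holds`, the mean-square input is
`Literature.NumberTheory.LFunctions.exists_integral_norm_sq_riemannZeta_Icc_ge`).
[cite: BettinGonek2017, Theorem 2] -/
theorem BettinGonek2017_thm2_holds : BettinGonek2017_thm2 :=
  BettinGonek2017_thm2_of_lowerBound BettinGonek2017_lowerBound_holds
    Literature.NumberTheory.LFunctions.exists_integral_norm_sq_riemannZeta_Icc_ge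

/-- Bettin–Gonek's printed corollary of Theorem 2, now unconditional in its analytic input: "if
`I_N(T,2T) ≪_ε T^{1+ε}` for `2 ≤ N ≤ T^θ` with `θ` arbitrarily large, then the Riemann hypothesis
is true". [cite: BettinGonek2017, Theorem 2] -/
theorem riemannHypothesis_of_mollifiedSecondMoment_dyadic_bound
    (hyp : ∀ θ : ℝ, 0 < θ → ∀ ε : ℝ, 0 < ε → ∃ C : ℝ, ∀ T : ℝ, 2 ≤ T → ∀ N : ℕ, 2 ≤ N →
      (N : ℝ) ≤ T ^ θ → mollifiedSecondMoment N T (2 * T) ≤ C * T ^ (1 + ε)) :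
    RiemannHypothesis :=
  BettinGonek2017_thm2.riemannHypothesis BettinGonek2017_thm2_holds hyp

end Literature.Barriers.RiemannHypothesis
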